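import Literature.Geometry.ComplexHyperbolic.UnitBallPolarCoordinates     -- ★ p842363 (F0P3a-p05): `exists_angularMeasure`, `integral_eq_integral_polar`, `nsq_real_smul`
import Literature.Geometry.ComplexHyperbolic.UnitBallSheetIntegralBounds   -- ★ p842948 (F0P3a-p05): `integrable_indicator_nsq_le_mul_norm_rpow_neg`, `norm_le_sqrt_nsq`, `integrable_indicator_nsq_le_const`
import Mathlib.MeasureTheory.Integral.IntegralEqImproper                   -- `integral_Ioi_of_hasDerivAt_of_tendsto` (FTC on `(0, ∞)`)
import Mathlib.Analysis.SpecialFunctions.Pow.Deriv                         -- `Real.hasDerivAt_rpow_const`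
import HarnessLib

/-!
# Radial integration by parts on `ℂ² = ℝ⁴` against homogeneous weights: Euler's identity and the vertex term
# (ROAD A (A4-E): the Θ-free engine of the value identity (A4-iii) at the centre of `U(2,1)`)

Topic `Geometry/ComplexHyperbolic`; namespace `Literature.Geometry.ComplexHyperbolic.BallModel`.  THEOREMS ONLY (no `def`, no instance,
no notation, no axiom, no named fact, no `sorry`).  Cell `pub/hodgecm-mathlib`, ENGINE T1 (crux H413 = `stmt-HodgeConjecture-24833`); floor-1½,
count-neutral, under «SdArch» ED. 3 node N1 = the (L_{U(2,1)}) letter ★ `ArchCentralLimitFormulaRankTwo` (`stub_ArchCentralLimitU21`): brick **(A4-E)**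
of the ROAD A owner F0P3a-p05 (g13)'s census `CENSUS-A4-ValueInTheChart` 19b229d9 §3 («mechanism = integration by parts on `ℂ² = ℝ⁴` with LEBESGUE
measure: EULER SCALING `∫ DΛ(W)[W] d⁴W = −4∫Λ d⁴W` …; the radial IBP `∫_0^∞ ∂_r(…) r³dr` against `r⁻³` leaves the BOUNDARY TERM AT `r = 0`,
`= vol(S³)·(…)(0) ∝ Θ(u•1)` — this is where the vertex value is born»); author F0P3a-p06 (g12), 2026-09-01.

THE MATHEMATICS.  After the blow-up (★ `UnitBallKCentralConeLimit`) the jets of the `|1 − w|²`-normalised wall germs `ψ, χ` of ★ (A4)-I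
(`ArchCentralLimitCompactWallOrbital`) are integrals over `W ∈ ℂ²` of cone data `Ξ(W, √(nsq W))` against the weights `|W|⁻¹, |W|⁻², |W|⁻³`
(`|W| = √(nsq W)`; two `ε`-derivatives of `√(ε + nsq W)`, ★ `hasDerivAt_inv_two_mul_sqrt_add_const`).  ALONG A RAY `r ↦ r•ω` (`nsq ω = 1`)
such data are smooth in `r ∈ [0, ∞)` INCLUDING `r = 0` (`√(nsq (r•ω)) = r`), although they need not be differentiable at the origin of `ℂ²`.
In polar coordinates `d⁴W = r³ dr dσ(ω)` (★ `integral_eq_integral_polar`, `σ(univ) = 4·vol{nsq < 1} = |S³| = 2π²`) every such integral is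
`∫_σ ∫_0^∞ r³ k(rω) dr`, and when `r³ k(rω) = ∂_r K_ω(r)` with `K_ω → 0` at `∞`:
* if `K_ω(0⁺) = 0` the integral VANISHES (EULER: `K_ω(r) = r^{3+b} f(rω)`, `b > −3`, gives `∫ |W|^b ∂_r f = −(3+b) ∫ |W|^{b−1} f`; at `b = 0`
  Euler's scaling identity `∫ Df(W)[W] d⁴W = −4 ∫ f`);
* if `K_ω(0⁺) = K₀` is the same for every `ω` the integral is `−σ(univ)·K₀` (THE VERTEX TERM: `K_ω(r) = f(rω)` gives
  `∫ |W|⁻³ ∂_r f d⁴W = −|S³|·f(0)`, i.e. `div(W∕|W|⁴) = |S³|·δ₀` tested against `f`).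

* §1 `sqrt_nsq_real_smul`, `ae_integrableOn_Ioi_pow_smul_comp_smul` (a.e.-ray integrability of `r³k(rω)` from `Integrable k`), ray lemmas for
  functions on `ℂ²` (`hasDerivAt_comp_smul_of_differentiableAt`, `eventually_atTop_comp_smul_eq_zero`) and for cone data (`hasDerivAt_comp_smul_sqrt_nsq`);
* §2 THE POLAR-READY CORE `integral_eq_neg_smul_of_hasDerivAt_polar` (`∫ k = −σ(univ)•K₀`), `integral_eq_zero_of_hasDerivAt_polar`;
* §3 EULER `integral_rpow_smul_radialDeriv_eq` (`b > −3`), fderiv form `integral_rpow_smul_fderiv_apply_self_eq` (`p < 4`), `integral_fderiv_apply_self_eq` (`p = 0`);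
* §4 THE VERTEX TERM `integral_inv_sqrt_nsq_cube_smul_radialDeriv_eq`, fderiv form `integral_inv_nsq_sq_smul_fderiv_apply_self_eq`;
* §5 integrability side conditions: `integrable_rpow_sqrt_nsq_smul_of_bound`, `integrable_inv_sqrt_nsq_pow_smul_of_bound` (weights `|W|^b`, `−4 < b ≤ 0`,
  against bounded data vanishing off `{nsq ≤ S}`).
HONEST LABEL: HC_CM is proved only modulo the printed citations until rung 0 closes; this file is real analysis over ★ ball-model files and pays nothing by itself.

## References
* [Rudin1980] W. Rudin, *Function Theory in the Unit Ball of ℂⁿ* (1980), §1.4 (1.4.3: integration in polar coordinates on `ℂⁿ`).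
* [HormanderALPDO1] L. Hörmander, *The Analysis of Linear Partial Differential Operators I*, 2nd ed. (1990), §3.2 (3.2.19)′ (Euler's identity),
  Thm. 3.3.2 (the fundamental solution `c_n|x|^{2−n}`: the boundary term at the origin of the radial integration by parts).
* [Varadarajan1989] V. S. Varadarajan, *An Introduction to Harmonic Analysis on Semisimple Lie Groups* (1989), §6.4 (Thm. 24: the delta at the vertex
  of the nilpotent cone by radial integration by parts).
* [Rogawski1990] J. D. Rogawski, *Automorphic Representations of Unitary Groups in Three Variables*, Ann. of Math. Stud. 123 (1990), §8.4 pp. 126–127.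
-/

noncomputable section

open MeasureTheory MeasureTheory.Measure Set Filter Topology
open scoped ENNReal

namespace Literature.Geometry.ComplexHyperbolic.BallModel

variable {G : Type*} [NormedAddCommGroup G] [NormedSpace ℝ G]

/-! ### §1 Rays: `√(nsq (r•ω)) = r`, a.e.-ray integrability of `r³ k(rω)`, ray derivatives -/

/-- On the ray through a unit vector, `√(nsq (r•ω)) = r` (`r ≥ 0`, `nsq ω = 1`). [cite: Rudin1980, §1.4] -/
theorem sqrt_nsq_real_smul {ω : Fin 2 → ℂ} (hω : nsq ω = 1) {r : ℝ} (hr : 0 ≤ r) : Real.sqrt (nsq (r • ω)) = r := by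
  rw [nsq_real_smul, hω, mul_one, Real.sqrt_sq hr]

/-- A unit vector is not the origin. [cite: Rudin1980, §1.4] -/
theorem ne_zero_of_nsq_eq_one {ω : Fin 2 → ℂ} (hω : nsq ω = 1) : ω ≠ 0 := by
  intro h
  rw [h] at hω
  simp [nsq] at hω

/-- A point `r•ω` of a ray through a unit vector with `r > 0` is not the origin. [cite: Rudin1980, §1.4] -/
theorem real_smul_ne_zero_of_nsq_eq_one {ω : Fin 2 → ℂ} (hω : nsq ω = 1) {r : ℝ} (hr : 0 < r) : r • ω ≠ 0 := by
  intro h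
  have h1 : nsq (r • ω) = 0 := by rw [h]; simp [nsq]
  rw [nsq_real_smul, hω, mul_one] at h1
  exact absurd h1 (pow_ne_zero 2 hr.ne')

/-- **A.E.-RAY INTEGRABILITY**: if `k` is integrable on `ℂ²` then for `σ`-a.e. direction `ω` the polar integrand `r ↦ r³ • k(r•ω)` is integrable on `(0, ∞)`
(Fubini on `σ ⊗ r³dr` through the polar push-forward ★ `exists_angularMeasure`). [cite: Rudin1980, §1.4, 1.4.3] -/
theorem ae_integrableOn_Ioi_pow_smul_comp_smul {σ : Measure (Fin 2 → ℂ)} [SFinite σ]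
    (hσ : (σ.prod (volumeIoiPow 3)).map (fun p : (Fin 2 → ℂ) × Ioi (0 : ℝ) => (p.2 : ℝ) • p.1) = volume)
    {k : (Fin 2 → ℂ) → G} (hk : Integrable k) :
    ∀ᵐ ω ∂σ, IntegrableOn (fun r : ℝ => r ^ 3 • k (r • ω)) (Ioi 0) := by
  have hs : Measurable fun p : (Fin 2 → ℂ) × Ioi (0 : ℝ) => (p.2 : ℝ) • p.1 :=
    ((continuous_subtype_val.comp continuous_snd).smul continuous_fst).measurable
  have hkm : AEStronglyMeasurable k (((σ.prod (volumeIoiPow 3)).map fun p : (Fin 2 → ℂ) × Ioi (0 : ℝ) => (p.2 : ℝ) • p.1)) := by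
    rw [hσ]; exact hk.aestronglyMeasurable
  have hint : Integrable (k ∘ fun p : (Fin 2 → ℂ) × Ioi (0 : ℝ) => (p.2 : ℝ) • p.1) (σ.prod (volumeIoiPow 3)) := by
    refine (integrable_map_measure hkm hs.aemeasurable).1 ?_
    rw [hσ]; exact hk
  filter_upwards [hint.prod_right_ae] with ω hω
  have hd : Measurable fun r : Ioi (0 : ℝ) => ENNReal.ofReal ((r : ℝ) ^ 3) := by fun_prop
  rw [Measure.volumeIoiPow, integrable_withDensity_iff_integrable_smul' hd (Eventually.of_forall fun _ => ENNReal.ofReal_lt_top)] at hω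
  rw [integrableOn_iff_comap_subtypeVal measurableSet_Ioi]
  refine hω.congr (Eventually.of_forall fun r => ?_)
  simp only [Function.comp_apply, ENNReal.toReal_ofReal (pow_nonneg r.2.out.le 3)]

/-- RAY DERIVATIVE of a function differentiable off the origin: `(d∕ds) f(s•ω)|_{s=r} = Df(r•ω)[ω] = |r•ω|⁻¹ • Df(r•ω)[r•ω]` (`r > 0`, `nsq ω = 1`) —
the radial derivative `∂_r f = |W|⁻¹ Df(W)[W]` read along the ray. [cite: HormanderALPDO1, §3.2 (3.2.19)′] -/
theorem hasDerivAt_comp_smul_of_differentiableAt {f : (Fin 2 → ℂ) → G} (hf : ∀ W, W ≠ 0 → DifferentiableAt ℝ f W)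
    {ω : Fin 2 → ℂ} (hω : nsq ω = 1) {r : ℝ} (hr : 0 < r) :
    HasDerivAt (fun s : ℝ => f (s • ω)) ((fun W => (Real.sqrt (nsq W))⁻¹ • fderiv ℝ f W W) (r • ω)) r := by
  have hray : HasDerivAt (fun s : ℝ => s • ω) ((1 : ℝ) • ω) r := (hasDerivAt_id r).smul_const ω
  have h := (hf _ (real_smul_ne_zero_of_nsq_eq_one hω hr)).hasFDerivAt.comp_hasDerivAt r hray
  refine h.congr_deriv ?_
  simp only [one_smul, sqrt_nsq_real_smul hω hr.le, map_smul, smul_smul, inv_mul_cancel₀ hr.ne']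

/-- A compactly supported function VANISHES EVENTUALLY ALONG EVERY RAY through a unit vector. [cite: Rudin1980, §1.4] -/
theorem eventually_atTop_comp_smul_eq_zero {β : Type*} [Zero β] {f : (Fin 2 → ℂ) → β} (hsupp : HasCompactSupport f)
    {ω : Fin 2 → ℂ} (hω : nsq ω = 1) : ∀ᶠ s : ℝ in atTop, f (s • ω) = 0 := by
  obtain ⟨R, hR⟩ := (hsupp.isCompact.isBounded).subset_closedBall (0 : Fin 2 → ℂ)
  have hωpos : 0 < ‖ω‖ := norm_pos_iff.2 (ne_zero_of_nsq_eq_one hω)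
  filter_upwards [eventually_gt_atTop (R / ‖ω‖), eventually_gt_atTop (0 : ℝ)] with s hs hs0
  refine image_eq_zero_of_notMem_tsupport fun hmem => ?_
  have hle := hR hmem
  rw [mem_closedBall_zero_iff, norm_smul, Real.norm_eq_abs, abs_of_pos hs0] at hle
  rw [div_lt_iff₀ hωpos] at hs
  linarith

/-- A continuous function is continuous at `0⁺` ALONG EVERY RAY. [cite: Rudin1980, §1.4] -/
theorem continuousWithinAt_comp_smul {β : Type*} [TopologicalSpace β] {f : (Fin 2 → ℂ) → β} (hc : Continuous f) (ω : Fin 2 → ℂ) :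
    ContinuousWithinAt (fun s : ℝ => f (s • ω)) (Ici 0) 0 := by
  have h : Continuous fun s : ℝ => f (s • ω) := hc.comp (continuous_id.smul continuous_const)
  exact h.continuousWithinAt

/-- RAY DERIVATIVE OF CONE DATA: along the ray `s ↦ s•ω` (`nsq ω = 1`) the cone datum `W ↦ Ξ(W, √(nsq W))` is `s ↦ Ξ(s•ω, s)` for `s > 0`, hence has derivative
`DΞ(r•ω, r)[(ω, 1)]` at `r > 0` — smooth in `r` although `W ↦ √(nsq W)` is not differentiable at the origin. [cite: Varadarajan1989, §6.4] -/
theorem hasDerivAt_comp_smul_sqrt_nsq {Ξ : (Fin 2 → ℂ) × ℝ → G} {ω : Fin 2 → ℂ} (hω : nsq ω = 1) {r : ℝ} (hr : 0 < r)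
    (hΞ : DifferentiableAt ℝ Ξ (r • ω, r)) :
    HasDerivAt (fun s : ℝ => Ξ (s • ω, Real.sqrt (nsq (s • ω)))) (fderiv ℝ Ξ (r • ω, r) (ω, 1)) r := by
  have hinner : HasDerivAt (fun s : ℝ => (s • ω, s)) ((1 : ℝ) • ω, (1 : ℝ)) r := ((hasDerivAt_id r).smul_const ω).prodMk (hasDerivAt_id r)
  have h := HasFDerivAt.comp_hasDerivAt (f := fun s : ℝ => (s • ω, s)) r hΞ.hasFDerivAt hinner
  rw [one_smul] at h
  refine h.congr_of_eventuallyEq ?_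
  filter_upwards [Ioi_mem_nhds hr] with s hs
  simp only [Function.comp_apply, sqrt_nsq_real_smul hω (le_of_lt hs)]

/-! ### §2 The polar-ready core: `∫ k = −σ(univ) • K₀` when `r³k(rω) = ∂_r K_ω`, `K_ω(∞) = 0`, `K_ω(0⁺) = K₀` -/

section Core

variable [CompleteSpace G]

/-- **RADIAL INTEGRATION BY PARTS ON `ℂ²`, POLAR-READY CORE.**  Let `σ` be an angular measure (★ `exists_angularMeasure`: carried by `{nsq = 1}`, with
`(σ ⊗ r³dr)∘(r•ω)⁻¹ = vol`).  If `k` is integrable on `ℂ²` and along every unit ray `r³ • k(r•ω) = (d∕dr) K_ω(r)` on `(0,∞)`, with `K_ω` continuous at `0⁺`,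
`K_ω(0) = K₀` (the same for all `ω`) and `K_ω → 0` at `∞`, then **`∫_{ℂ²} k = −σ(univ) • K₀`** — the boundary term at the vertex `r = 0`
(`∫ k = ∫_σ ∫_0^∞ ∂_r K_ω = ∫_σ (0 − K₀)`). [cite: HormanderALPDO1, Thm. 3.3.2] [cite: Rudin1980, §1.4, 1.4.3] -/
theorem integral_eq_neg_smul_of_hasDerivAt_polar {σ : Measure (Fin 2 → ℂ)} [SFinite σ]
    (hσ : (σ.prod (volumeIoiPow 3)).map (fun p : (Fin 2 → ℂ) × Ioi (0 : ℝ) => (p.2 : ℝ) • p.1) = volume)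
    (hσ1 : ∀ᵐ ω ∂σ, nsq ω = 1) {k : (Fin 2 → ℂ) → G} (hk : Integrable k) (K : (Fin 2 → ℂ) → ℝ → G) (K₀ : G)
    (hderiv : ∀ ω, nsq ω = 1 → ∀ r ∈ Ioi (0 : ℝ), HasDerivAt (K ω) (r ^ 3 • k (r • ω)) r)
    (hcont : ∀ ω, nsq ω = 1 → ContinuousWithinAt (K ω) (Ici 0) 0) (hK0 : ∀ ω, nsq ω = 1 → K ω 0 = K₀)
    (hinf : ∀ ω, nsq ω = 1 → Tendsto (K ω) atTop (𝓝 0)) :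
    ∫ W, k W = -(σ.real univ • K₀) := by
  rw [integral_eq_integral_polar hσ k hk]
  have h : ∀ᵐ ω ∂σ, (∫ r in Ioi (0 : ℝ), r ^ 3 • k (r • ω)) = -K₀ := by
    filter_upwards [ae_integrableOn_Ioi_pow_smul_comp_smul hσ hk, hσ1] with ω hω h1
    rw [integral_Ioi_of_hasDerivAt_of_tendsto (hcont ω h1) (hderiv ω h1) hω (hinf ω h1), hK0 ω h1, zero_sub]
  rw [integral_congr_ae h, integral_neg, integral_const]

/-- **RADIAL INTEGRATION BY PARTS ON `ℂ²`, VANISHING FORM**: as ★ `integral_eq_neg_smul_of_hasDerivAt_polar` with `K_ω(0) = 0`: `∫_{ℂ²} k = 0`.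
[cite: HormanderALPDO1, §3.2 (3.2.19)′] [cite: Rudin1980, §1.4, 1.4.3] -/
theorem integral_eq_zero_of_hasDerivAt_polar {σ : Measure (Fin 2 → ℂ)} [SFinite σ]
    (hσ : (σ.prod (volumeIoiPow 3)).map (fun p : (Fin 2 → ℂ) × Ioi (0 : ℝ) => (p.2 : ℝ) • p.1) = volume)
    (hσ1 : ∀ᵐ ω ∂σ, nsq ω = 1) {k : (Fin 2 → ℂ) → G} (hk : Integrable k) (K : (Fin 2 → ℂ) → ℝ → G)
    (hderiv : ∀ ω, nsq ω = 1 → ∀ r ∈ Ioi (0 : ℝ), HasDerivAt (K ω) (r ^ 3 • k (r • ω)) r)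
    (hcont : ∀ ω, nsq ω = 1 → ContinuousWithinAt (K ω) (Ici 0) 0) (hK0 : ∀ ω, nsq ω = 1 → K ω 0 = 0)
    (hinf : ∀ ω, nsq ω = 1 → Tendsto (K ω) atTop (𝓝 0)) :
    ∫ W, k W = 0 := by
  rw [integral_eq_neg_smul_of_hasDerivAt_polar hσ hσ1 hk K 0 hderiv hcont hK0 hinf, smul_zero, neg_zero]

end Core

/-! ### §3 Euler's identity against the homogeneous weight `|W|^b`, `b > −3` -/

section Euler

variable [CompleteSpace G]

/-- `r³·r^b = r^{3+b}` for `r > 0` (real exponent). [cite: HormanderALPDO1, §3.2 (3.2.19)′] -/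
theorem pow_three_mul_rpow {r : ℝ} (hr : 0 < r) (b : ℝ) : r ^ 3 * r ^ b = r ^ (3 + b) := by
  rw [Real.rpow_add hr, ← Real.rpow_natCast r 3, Nat.cast_ofNat]

/-- **EULER'S IDENTITY AGAINST A HOMOGENEOUS WEIGHT.**  Let `f, f₁ : ℂ² → G` with `f₁ = ∂_r f` along every unit ray (`HasDerivAt (s ↦ f(s•ω)) (f₁(r•ω)) r`,
`r > 0`, `nsq ω = 1`), `f` continuous at `0⁺` along rays and eventually `0` along rays, and let `b > −3` with `|W|^b • f₁` and `|W|^{b−1} • f` integrable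
(`|W| = √(nsq W)`).  Then **`∫ |W|^b • f₁ d⁴W = −(3 + b) • ∫ |W|^{b−1} • f d⁴W`** — the radial primitive `K_ω(r) = r^{3+b} f(rω)` vanishes at both ends.
(`b = 0`: `∫ ∂_r f = −3∫ f∕|W|`; with `∂_r f = Df(W)[W]∕|W|` and `p = 1 − b < 4`: `∫ |W|^{−p} Df(W)[W] = −(4 − p)∫ |W|^{−p} f`.)
[cite: HormanderALPDO1, §3.2 (3.2.19)′] [cite: Rudin1980, §1.4, 1.4.3] -/
theorem integral_rpow_smul_radialDeriv_eq {b : ℝ} (hb : -3 < b) {f f₁ : (Fin 2 → ℂ) → G}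
    (hderiv : ∀ ω, nsq ω = 1 → ∀ r ∈ Ioi (0 : ℝ), HasDerivAt (fun s : ℝ => f (s • ω)) (f₁ (r • ω)) r)
    (hcont : ∀ ω, nsq ω = 1 → ContinuousWithinAt (fun s : ℝ => f (s • ω)) (Ici 0) 0)
    (hzero : ∀ ω, nsq ω = 1 → ∀ᶠ s : ℝ in atTop, f (s • ω) = 0)
    (h₁ : Integrable fun W => Real.sqrt (nsq W) ^ b • f₁ W) (h₀ : Integrable fun W => Real.sqrt (nsq W) ^ (b - 1) • f W) :
    ∫ W, Real.sqrt (nsq W) ^ b • f₁ W = -((3 + b) • ∫ W, Real.sqrt (nsq W) ^ (b - 1) • f W) := by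
  obtain ⟨σ, hfin, hσ1, -, hσ⟩ := exists_angularMeasure
  have hb3 : 0 < 3 + b := by linarith
  have key := integral_eq_zero_of_hasDerivAt_polar hσ hσ1 (h₁.add (h₀.smul (3 + b)))
    (fun ω r => r ^ (3 + b) • f (r • ω)) ?_ ?_ ?_ ?_
  · rw [integral_add' h₁ (h₀.smul (3 + b))] at key
    simp only [Pi.smul_apply, integral_smul] at key
    exact eq_neg_of_add_eq_zero_left key
  · intro ω hω r hr
    have hr : 0 < r := hr
    have hd := (Real.hasDerivAt_rpow_const (x := r) (p := 3 + b) (Or.inl hr.ne')).smul (hderiv ω hω r hr)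
    refine hd.congr_deriv ?_
    have e1 : r ^ 3 * r ^ b = r ^ (3 + b) := pow_three_mul_rpow hr b
    have e2 : r ^ 3 * r ^ (b - 1) = r ^ (3 + b - 1) := by rw [pow_three_mul_rpow hr, show 3 + (b - 1) = 3 + b - 1 by ring]
    rw [← e1, ← e2]
    simp only [Pi.add_apply, Pi.smul_apply, sqrt_nsq_real_smul hω hr.le]
    module
  · intro ω hω
    exact ((Real.continuous_rpow_const hb3.le).continuousWithinAt).smul (hcont ω hω)
  · intro ω _
    simp only [Real.zero_rpow hb3.ne', zero_smul]
  · intro ω hω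
    refine (tendsto_const_nhds (x := (0 : G))).congr' ?_
    filter_upwards [hzero ω hω] with s hs
    rw [hs, smul_zero]

/-- **EULER'S IDENTITY, `fderiv` FORM**: for `f : ℂ² → G` continuous, compactly supported and differentiable off the origin, and `p < 4` with
`|W|^{−p} • Df(W)[W]` and `|W|^{−p} • f` integrable: **`∫ |W|^{−p} • Df(W)[W] d⁴W = −(4 − p) • ∫ |W|^{−p} • f d⁴W`** (`Df(W)[W] = |W|·∂_r f`).
[cite: HormanderALPDO1, §3.2 (3.2.19)′] [cite: Rudin1980, §1.4, 1.4.3] -/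
theorem integral_rpow_smul_fderiv_apply_self_eq {p : ℝ} (hp : p < 4) {f : (Fin 2 → ℂ) → G}
    (hf : ∀ W, W ≠ 0 → DifferentiableAt ℝ f W) (hc : Continuous f) (hsupp : HasCompactSupport f)
    (h₁ : Integrable fun W => Real.sqrt (nsq W) ^ (-p) • fderiv ℝ f W W) (h₀ : Integrable fun W => Real.sqrt (nsq W) ^ (-p) • f W) :
    ∫ W, Real.sqrt (nsq W) ^ (-p) • fderiv ℝ f W W = -((4 - p) • ∫ W, Real.sqrt (nsq W) ^ (-p) • f W) := by
  -- radial derivative `f₁ = |W|⁻¹ • Df(W)[W]`; weight exponent `b = 1 − p`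
  have hfun : (fun W => Real.sqrt (nsq W) ^ (1 - p) • ((Real.sqrt (nsq W))⁻¹ • fderiv ℝ f W W)) =
      fun W => Real.sqrt (nsq W) ^ (-p) • fderiv ℝ f W W := by
    funext W
    by_cases hW : W = 0
    · subst hW; simp
    · have hpos : 0 < Real.sqrt (nsq W) := Real.sqrt_pos.2 (nsq_pos_of_ne_zero hW)
      rw [smul_smul, ← div_eq_mul_inv, ← Real.rpow_sub_one hpos.ne', show (1 - p - 1) = -p by ring]
  have h₁' : Integrable fun W => Real.sqrt (nsq W) ^ (1 - p) • ((Real.sqrt (nsq W))⁻¹ • fderiv ℝ f W W) := by rw [hfun]; exact h₁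
  have h₀' : Integrable fun W => Real.sqrt (nsq W) ^ (1 - p - 1) • f W := by rw [show (1 - p - 1) = -p by ring]; exact h₀
  have key := integral_rpow_smul_radialDeriv_eq (b := 1 - p) (by linarith) (fun ω hω r hr => hasDerivAt_comp_smul_of_differentiableAt hf hω hr)
    (fun ω _ => continuousWithinAt_comp_smul hc ω) (fun ω hω => eventually_atTop_comp_smul_eq_zero hsupp hω) h₁' h₀'
  rw [hfun, show (1 - p - 1) = -p by ring, show (3 + (1 - p)) = 4 - p by ring] at key
  exact key

/-- **EULER'S SCALING IDENTITY** `∫_{ℂ²} Df(W)[W] d⁴W = −4 ∫_{ℂ²} f d⁴W` for `f ∈ C¹_c(ℂ², G)` (`d∕dλ|_{λ=1} ∫ f(λW) d⁴W`, `∫ f(λW) = λ⁻⁴∫f`).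
[cite: HormanderALPDO1, §3.2 (3.2.19)′] -/
theorem integral_fderiv_apply_self_eq {f : (Fin 2 → ℂ) → G} (hf : ContDiff ℝ 1 f) (hsupp : HasCompactSupport f) :
    ∫ W, fderiv ℝ f W W = -((4 : ℝ) • ∫ W, f W) := by
  have hcont : Continuous fun W => fderiv ℝ f W W := (hf.continuous_fderiv one_ne_zero).clm_apply continuous_id
  have hs : HasCompactSupport fun W => fderiv ℝ f W W := by
    refine (hsupp.fderiv (𝕜 := ℝ)).mono ?_
    intro W hW
    rw [Function.mem_support] at hW ⊢
    contrapose! hW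
    simp [hW]
  have key := integral_rpow_smul_fderiv_apply_self_eq (p := 0) (by norm_num) (fun W _ => (hf.differentiable one_ne_zero W))
    hf.continuous hsupp (by simpa using hcont.integrable_of_hasCompactSupport hs)
    (by simpa using hf.continuous.integrable_of_hasCompactSupport hsupp)
  simpa using key

end Euler

/-! ### §4 The vertex term: weight `|W|⁻³` -/

section Vertex

variable [CompleteSpace G]

/-- **THE VERTEX TERM.**  Let `f, f₁ : ℂ² → G` with `f₁ = ∂_r f` along every unit ray (`HasDerivAt (s ↦ f(s•ω)) (f₁(r•ω)) r`, `r > 0`, `nsq ω = 1`), `f` continuous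
at `0⁺` along rays, eventually `0` along rays, and `|W|⁻³ • f₁` integrable.  Then **`∫_{ℂ²} |W|⁻³ • ∂_r f d⁴W = −(4·vol{nsq < 1}) • f(0) = −|S³|·f(0)`**:
in polar coordinates the weight cancels `r³` exactly, the radial primitive is `f(rω)` itself, and its value at the vertex survives — `div(W∕|W|⁴) = |S³|δ₀`.
[cite: HormanderALPDO1, Thm. 3.3.2] [cite: Varadarajan1989, §6.4] [cite: Rudin1980, §1.4, 1.4.3] -/
theorem integral_inv_sqrt_nsq_cube_smul_radialDeriv_eq {f f₁ : (Fin 2 → ℂ) → G}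
    (hderiv : ∀ ω, nsq ω = 1 → ∀ r ∈ Ioi (0 : ℝ), HasDerivAt (fun s : ℝ => f (s • ω)) (f₁ (r • ω)) r)
    (hcont : ∀ ω, nsq ω = 1 → ContinuousWithinAt (fun s : ℝ => f (s • ω)) (Ici 0) 0)
    (hzero : ∀ ω, nsq ω = 1 → ∀ᶠ s : ℝ in atTop, f (s • ω) = 0)
    (h₁ : Integrable fun W => (Real.sqrt (nsq W) ^ 3)⁻¹ • f₁ W) :
    ∫ W, (Real.sqrt (nsq W) ^ 3)⁻¹ • f₁ W = -((4 * (volume {W : Fin 2 → ℂ | nsq W < 1}).toReal) • f 0) := by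
  obtain ⟨σ, hfin, hσ1, hmass, hσ⟩ := exists_angularMeasure
  have key := integral_eq_neg_smul_of_hasDerivAt_polar hσ hσ1 h₁ (fun ω r => f (r • ω)) (f 0) ?_ hcont (fun ω _ => by simp) ?_
  · rw [key, measureReal_def, hmass, ENNReal.toReal_mul, ENNReal.toReal_ofNat]
  · intro ω hω r hr
    have hr : 0 < r := hr
    refine (hderiv ω hω r hr).congr_deriv ?_
    rw [sqrt_nsq_real_smul hω hr.le, smul_smul, mul_inv_cancel₀ (pow_ne_zero 3 hr.ne'), one_smul]
  · intro ω hω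
    refine (tendsto_const_nhds (x := (0 : G))).congr' ?_
    filter_upwards [hzero ω hω] with s hs
    exact hs.symm

/-- **THE VERTEX TERM, `fderiv` FORM**: for `f : ℂ² → G` continuous, compactly supported, differentiable off the origin, with `|W|⁻⁴ • Df(W)[W]` integrable:
**`∫_{ℂ²} (nsq W)⁻² • Df(W)[W] d⁴W = −(4·vol{nsq < 1}) • f(0) = −2π²·f(0)`** (`Df(W)[W] = |W|·∂_r f`). [cite: HormanderALPDO1, Thm. 3.3.2] [cite: Rudin1980, §1.4, 1.4.3] -/
theorem integral_inv_nsq_sq_smul_fderiv_apply_self_eq {f : (Fin 2 → ℂ) → G}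
    (hf : ∀ W, W ≠ 0 → DifferentiableAt ℝ f W) (hc : Continuous f) (hsupp : HasCompactSupport f)
    (h₁ : Integrable fun W => (nsq W ^ 2)⁻¹ • fderiv ℝ f W W) :
    ∫ W, (nsq W ^ 2)⁻¹ • fderiv ℝ f W W = -((4 * (volume {W : Fin 2 → ℂ | nsq W < 1}).toReal) • f 0) := by
  have hfun : (fun W => (Real.sqrt (nsq W) ^ 3)⁻¹ • ((Real.sqrt (nsq W))⁻¹ • fderiv ℝ f W W)) = fun W => (nsq W ^ 2)⁻¹ • fderiv ℝ f W W := by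
    funext W
    have h4 : Real.sqrt (nsq W) ^ 3 * Real.sqrt (nsq W) = nsq W ^ 2 := by
      rw [← pow_succ, show (3 + 1 : ℕ) = 2 * 2 from rfl, pow_mul, Real.sq_sqrt (nsq_nonneg W)]
    rw [smul_smul, ← mul_inv, h4]
  have h₁' : Integrable fun W => (Real.sqrt (nsq W) ^ 3)⁻¹ • ((Real.sqrt (nsq W))⁻¹ • fderiv ℝ f W W) := by rw [hfun]; exact h₁
  have key := integral_inv_sqrt_nsq_cube_smul_radialDeriv_eq (fun ω hω r hr => hasDerivAt_comp_smul_of_differentiableAt hf hω hr)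
    (fun ω _ => continuousWithinAt_comp_smul hc ω) (fun ω hω => eventually_atTop_comp_smul_eq_zero hsupp hω) h₁'
  rw [hfun] at key
  exact key

end Vertex

/-! ### §5 Integrability of homogeneous weights against bounded data vanishing off `{nsq ≤ S}` -/

section Integrability

/-- **WEIGHTED INTEGRABILITY**: for `g` a.e.-strongly measurable, bounded (`‖g‖ ≤ M`) and vanishing off `{nsq ≤ S}`, and `−4 < b ≤ 0`, the function `|W|^b • g`
is integrable on `ℂ²` (majorant `𝟙{nsq ≤ S}·M·‖W‖_∞^b` ★ `integrable_indicator_nsq_le_mul_norm_rpow_neg`, `‖W‖_∞ ≤ |W|`). [cite: Rudin1980, §1.4] -/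
theorem integrable_rpow_sqrt_nsq_smul_of_bound {g : (Fin 2 → ℂ) → G} (hg : AEStronglyMeasurable g volume)
    {b : ℝ} (hb : -4 < b) (hb0 : b ≤ 0) {S M : ℝ} (hM : ∀ W, ‖g W‖ ≤ M) (hS : ∀ W, S < nsq W → g W = 0) :
    Integrable fun W => Real.sqrt (nsq W) ^ b • g W := by
  have hM0 : 0 ≤ M := (norm_nonneg _).trans (hM 0)
  have hmeas : AEStronglyMeasurable (fun W => Real.sqrt (nsq W) ^ b • g W) volume :=
    ((Real.continuous_sqrt.measurable.comp continuous_fun_nsq.measurable).pow_const b).aestronglyMeasurable.smul hg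
  refine (integrable_indicator_nsq_le_mul_norm_rpow_neg S M (k := -b) (by linarith)).mono' hmeas (Eventually.of_forall fun W => ?_)
  rw [norm_smul, Real.norm_of_nonneg (Real.rpow_nonneg (Real.sqrt_nonneg _) b), neg_neg]
  by_cases hWS : nsq W ≤ S
  · rw [indicator_of_mem (show W ∈ {W : Fin 2 → ℂ | nsq W ≤ S} from hWS)]
    by_cases hW : W = 0
    · subst hW
      rcases eq_or_lt_of_le hb0 with hb' | hb'
      · simp [hb', nsq, hM 0]
      · have : Real.sqrt (nsq (0 : Fin 2 → ℂ)) ^ b = 0 := by simp [nsq, Real.zero_rpow hb'.ne]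
        rw [this, zero_mul]
        exact mul_nonneg hM0 (Real.rpow_nonneg (norm_nonneg _) _)
    · have hnpos : 0 < ‖W‖ := norm_pos_iff.2 hW
      have hle : Real.sqrt (nsq W) ^ b ≤ ‖W‖ ^ b := Real.rpow_le_rpow_of_nonpos hnpos (norm_le_sqrt_nsq W) hb0
      calc Real.sqrt (nsq W) ^ b * ‖g W‖ ≤ ‖W‖ ^ b * M :=
            mul_le_mul hle (hM W) (norm_nonneg _) (Real.rpow_nonneg (norm_nonneg _) _)
        _ = M * ‖W‖ ^ b := mul_comm _ _
  · rw [hS W (not_le.mp hWS), norm_zero, mul_zero]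
    exact Set.indicator_nonneg (fun W _ => mul_nonneg hM0 (Real.rpow_nonneg (norm_nonneg _) _)) W

/-- **WEIGHTED INTEGRABILITY, integer weights**: for `g` as above and `n < 4`, `(|W|^n)⁻¹ • g` is integrable on `ℂ²` — the weights `|W|⁻¹, |W|⁻², |W|⁻³` of the
`ε`-derivatives on the null cone (★ `hasDerivAt_inv_two_mul_sqrt_add_const` at `ε = 0`). [cite: Rudin1980, §1.4] -/
theorem integrable_inv_sqrt_nsq_pow_smul_of_bound {g : (Fin 2 → ℂ) → G} (hg : AEStronglyMeasurable g volume)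
    {n : ℕ} (hn : n < 4) {S M : ℝ} (hM : ∀ W, ‖g W‖ ≤ M) (hS : ∀ W, S < nsq W → g W = 0) :
    Integrable fun W => (Real.sqrt (nsq W) ^ n)⁻¹ • g W := by
  have hfun : (fun W => Real.sqrt (nsq W) ^ (-(n : ℝ)) • g W) = fun W => (Real.sqrt (nsq W) ^ n)⁻¹ • g W := by
    funext W
    rw [Real.rpow_neg (Real.sqrt_nonneg _), Real.rpow_natCast]
  have hn' : -4 < -(n : ℝ) := by
    have : (n : ℝ) < 4 := by exact_mod_cast hn
    linarith
  rw [← hfun]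
  exact integrable_rpow_sqrt_nsq_smul_of_bound hg hn' (by simp) hM hS

/-- Data continuous off the origin are a.e.-strongly measurable on `ℂ²` (the origin is Lebesgue-null; cf. ★ `aestronglyMeasurable_of_continuousOn_ne_zero`). [cite: Rudin1980, §1.4] -/
theorem aestronglyMeasurable_of_continuousOn_compl_zero {β : Type*} [TopologicalSpace β] [TopologicalSpace.PseudoMetrizableSpace β]
    {g : (Fin 2 → ℂ) → β} (hg : ContinuousOn g {0}ᶜ) : AEStronglyMeasurable g (volume : Measure (Fin 2 → ℂ)) := by
  have hs : MeasurableSet ({0}ᶜ : Set (Fin 2 → ℂ)) := (measurableSet_singleton (0 : Fin 2 → ℂ)).compl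
  rw [← Measure.restrict_eq_self_of_ae_mem (ae_ne_zero_volume_fin_two_complex : ∀ᵐ W : Fin 2 → ℂ, W ∈ ({0}ᶜ : Set (Fin 2 → ℂ)))]
  exact hg.aestronglyMeasurable hs

end Integrability

end Literature.Geometry.ComplexHyperbolic.BallModel

end
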